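import Mathlib
import Summits.ValiantsHypothesis.ValiantsHypothesis.Theorems.LiouvilleSarnakLiouvilleCutRankCertifiedCutPoints
import Literature.Computability.AlgebraicComplexity.BooleanGadgets
import HarnessLib

/-!
# Route LiouvilleSarnak — crux `LiouvilleCutRank` (stmt-ValiantsHypothesis-14775):
# EVERY cut with pairwise non-adjacent row bits has rank `≥ ⌊log₂ n⌋` (a non-periodic class, quantitative)

The certificate criterion `…CertifiedCutPoints.card_le_two_pow_rank_of_certified` is applied to an ARBITRARY
(balanced or not, periodic or not) cut `π` of the `2n` bit positions in which NO TWO ROW POSITIONS ARE ADJACENT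
(the cut word has no factor `RR`; e.g. every Sturmian / mechanical cut word with isolated `R`, `(C^a R)^*`-type
words, the bit-interleaving `(CR)^n`, …):

* ★★ `le_two_pow_rank_of_noAdjacentRows` — `n ≤ 2^{rank M_π}`; `log_le_rank_of_noAdjacentRows` —
  `⌊log₂ n⌋ ≤ rank M_π`.

Certificates: the cut points `p = (row position) + 1` (a column position, by the hypothesis) are pairwise
certified with `c = 3`: between `p < p'` the row positions `j ∈ [p+1, p')` give `m = Σ 2^{j-p} = 2x`,
`x = Σ 2^{j-p-1}`, and the bits of `x - 1` — those below the least exponent `e₀`, and the exponents `j - p - 1`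
above it — sit at the column positions `p + b` (positions strictly before the first row position after `p`, resp.
the predecessors `j - 1` of later row positions, which are columns since no two rows are adjacent).  So this is
the first unconditional result of the route for a NON-PERIODIC, NON-ALIGNED class of cut words, with an explicit
rate.  Honest framing: one class of the crux; `LiouvilleCutRank` (ALL balanced cuts), `DigitalBilinearLiouville`,
`AlgebraicSarnak` stay OPEN; nothing bears on `VP ≠ VNP`.  No definitions.
-/

set_option linter.dupNamespace false

noncomputable section

namespace Summit.ValiantsHypothesis.ValiantsHypothesis.Theorems.LiouvilleSarnakLiouvilleCutRank.NoAdjacentRows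

open ArithmeticFunction Finset

open Summit.ValiantsHypothesis.ValiantsHypothesis.Theorems.LiouvilleSarnakLiouvilleCutRank.CertifiedCutPoints
  (card_le_two_pow_rank_of_certified)
open Literature.Computability.AlgebraicComplexity.BoolGadgets (ofBits_eq_sum)

/-- Splitting a bit set at its least element: if `G e₀ = true` and `G e = false` for `e < e₀`, then
`ofBits G = 2^{e₀+1} · ofBits (G(· + e₀ + 1)) + 2^{e₀}` (on `N` positions, `G` extended by `false`). [folklore] -/
theorem ofBits_split_min (N : ℕ) (G : ℕ → Bool) (hGN : ∀ e, N ≤ e → G e = false) (e₀ : ℕ) (h0 : G e₀ = true)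
    (hmin : ∀ e, e < e₀ → G e = false) :
    Nat.ofBits (fun e : Fin N => G e) =
      2 ^ (e₀ + 1) * Nat.ofBits (fun e : Fin N => G ((e : ℕ) + e₀ + 1)) + 2 ^ e₀ := by
  have he₀N : e₀ < N := by
    by_contra h
    rw [hGN e₀ (by omega)] at h0
    exact Bool.false_ne_true h0
  apply Nat.eq_of_testBit_eq
  intro b
  rw [Nat.testBit_ofBits, Nat.testBit_two_pow_mul_add _ (by
      exact Nat.pow_lt_pow_right (by norm_num) (by omega) : 2 ^ e₀ < 2 ^ (e₀ + 1)),
    Nat.testBit_two_pow, Nat.testBit_ofBits]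
  by_cases hb : b < e₀ + 1
  · rw [if_pos hb]
    by_cases hbe : b = e₀
    · subst hbe
      simp [he₀N, h0]
    · have hbl : b < e₀ := by omega
      rw [dif_pos (by omega), hmin b hbl]
      simp [Ne.symm hbe]
  · rw [if_neg hb]
    by_cases hbN : b < N
    · rw [dif_pos hbN, dif_pos (by omega)]
      dsimp only
      congr 1
      omega
    · rw [dif_neg hbN]
      by_cases hbN' : b - (e₀ + 1) < N
      · rw [dif_pos hbN', hGN _ (by dsimp only; omega)]
      · rw [dif_neg hbN']

/-- ★★ **No two adjacent row positions ⟹ `n ≤ 2^{rank}`.**  For every cut `π` of the `2n` bit positions in which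
no two row positions are adjacent, the cut matrix `M_π(r,c) = λ(N_π(r,c)+1)` satisfies `n ≤ 2^{rank M_π}`.
[this file] -/
theorem le_two_pow_rank_of_noAdjacentRows (n : ℕ) (π : Fin n ⊕ Fin n ≃ Fin (2 * n))
    (hRR : ∀ i i' : Fin n, (π (Sum.inl i') : ℕ) ≠ (π (Sum.inl i) : ℕ) + 1) :
    n ≤ 2 ^ (Matrix.of fun r c : Fin n → Bool =>
      (((liouville (Nat.ofBits (fun k : Fin (2 * n) => Sum.elim r c (π.symm k)) + 1) : ℤ) : ℂ))).rank := by
  classical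
  have h3 : liouville 3 = -1 := by
    rw [liouville_apply (by norm_num : (3 : ℕ) ≠ 0), cardFactors_apply_prime Nat.prime_three]; norm_num
  -- positions: a position with `isLeft = false` is a column position; `isLeft = true` is a row position
  have hcol : ∀ j : Fin (2 * n), (π.symm j).isLeft = false → ∃ i : Fin n, (π (Sum.inr i) : ℕ) = j := by
    intro j h
    rcases hj : π.symm j with i | i
    · rw [hj] at h; simp at h
    · exact ⟨i, by rw [← hj, Equiv.apply_symm_apply]⟩
  have hrow : ∀ j : Fin (2 * n), (π.symm j).isLeft = true → ∃ i : Fin n, (π (Sum.inl i) : ℕ) = j := by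
    intro j h
    rcases hj : π.symm j with i | i
    · exact ⟨i, by rw [← hj, Equiv.apply_symm_apply]⟩
    · rw [hj] at h; simp at h
  -- a row position's successor and the point `π(inl i) + 1` are not row positions
  have hnotrow : ∀ (i : Fin n) (j : Fin (2 * n)), (j : ℕ) = (π (Sum.inl i) : ℕ) + 1 → (π.symm j).isLeft = false := by
    intro i j hj
    by_contra h
    rw [Bool.not_eq_false] at h
    obtain ⟨i', hi'⟩ := hrow j h
    exact hRR i i' (by omega)
  have key := card_le_two_pow_rank_of_certified n π
    ((Finset.univ : Finset (Fin n)).image fun i => (π (Sum.inl i) : ℕ) + 1)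
    (fun p hp => by
      obtain ⟨i, -, rfl⟩ := Finset.mem_image.mp hp
      have := (π (Sum.inl i)).2; omega)
    (fun p hp p' hp' hpp' => by
      obtain ⟨i, -, rfl⟩ := Finset.mem_image.mp hp
      obtain ⟨i', -, rfl⟩ := Finset.mem_image.mp hp'
      -- abbreviations
      set p := (π (Sum.inl i) : ℕ) + 1 with hpdef
      set p' := (π (Sum.inl i') : ℕ) + 1 with hp'def
      have hp'n : p' ≤ 2 * n := by have := (π (Sum.inl i')).2; omega
      have hii' : p + 1 ≤ (π (Sum.inl i') : ℕ) := by
        have h1 : (π (Sum.inl i) : ℕ) < (π (Sum.inl i') : ℕ) := by omega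
        have h2 := hRR i i'
        omega
      -- the bit function of the exponents `e = j - p - 1` of row positions `j ∈ [p+1, p')`
      set G : ℕ → Bool := fun e => if h : p + 1 + e < 2 * n then
        decide (p + 1 + e < p') && (π.symm ⟨p + 1 + e, h⟩).isLeft else false with hGdef
      have hGN : ∀ e, 2 * n ≤ e → G e = false := fun e he => by
        rw [hGdef]; simp only; rw [dif_neg (by omega)]
      have hGlt : ∀ e, G e = true → p + 1 + e < 2 * n := by
        intro e he
        by_contra h
        rw [hGdef] at he; simp only at he; rw [dif_neg h] at he
        exact Bool.false_ne_true he
      have hGp' : ∀ e, G e = true → p + 1 + e < p' := by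
        intro e he
        have h := hGlt e he
        rw [hGdef] at he; simp only at he; rw [dif_pos h] at he
        simp only [Bool.and_eq_true, decide_eq_true_eq] at he
        exact he.1
      have hGleft : ∀ e (he : G e = true), (π.symm ⟨p + 1 + e, hGlt e he⟩).isLeft = true := by
        intro e he
        have h := hGlt e he
        have he' := he
        rw [hGdef] at he'; simp only at he'; rw [dif_pos h] at he'
        simp only [Bool.and_eq_true, decide_eq_true_eq] at he'
        exact he'.2
      have hGintro : ∀ e (h : p + 1 + e < 2 * n), p + 1 + e < p' →
          (π.symm ⟨p + 1 + e, h⟩).isLeft = true → G e = true := by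
        intro e h h1 h2
        rw [hGdef]; simp only; rw [dif_pos h]
        simp only [Bool.and_eq_true, decide_eq_true_eq]
        exact ⟨h1, h2⟩
      -- `e₁ = π(inl i') - p - 1` is an exponent
      have he₁ : G ((π (Sum.inl i') : ℕ) - p - 1) = true := by
        have hlt : p + 1 + ((π (Sum.inl i') : ℕ) - p - 1) < 2 * n := by have := (π (Sum.inl i')).2; omega
        refine hGintro _ hlt (by omega) ?_
        have hj : (⟨p + 1 + ((π (Sum.inl i') : ℕ) - p - 1), hlt⟩ : Fin (2 * n)) = π (Sum.inl i') :=
          Fin.ext (by simp only; omega)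
        rw [hj, Equiv.symm_apply_apply]; rfl
      -- the least exponent
      have hex : ∃ e, G e = true := ⟨_, he₁⟩
      obtain ⟨e₀, hG0, hmin'⟩ : ∃ e₀, G e₀ = true ∧ ∀ e, e < e₀ → G e = false :=
        ⟨Nat.find hex, Nat.find_spec hex, fun e he => by
          have := Nat.find_min hex he; simpa using this⟩
      have h0N := hGlt e₀ hG0
      have h0p' := hGp' e₀ hG0
      -- the certificate `x`
      have hxsplit := ofBits_split_min (2 * n) G hGN e₀ hG0 hmin'
      have hx1 : 1 ≤ Nat.ofBits (fun e : Fin (2 * n) => G e) := by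
        rw [hxsplit]; have := Nat.one_le_two_pow (n := e₀); omega
      refine ⟨3, Nat.ofBits (fun e : Fin (2 * n) => G e), h3, hx1, ?_, ?_⟩
      · -- `x * 2 = m`: reindex `e ↦ j = p + 1 + e`
        have hGne : ∀ e : Fin (2 * n), (G e).toNat * 2 ^ (e : ℕ) * (3 - 1) ≠ 0 → G e = true := by
          intro e hne
          by_contra h
          rw [Bool.not_eq_true] at h
          rw [h] at hne
          simp at hne
        rw [ofBits_eq_sum, Finset.sum_mul]
        refine Finset.sum_bij_ne_zero (fun e _ hne => (⟨p + 1 + (e : ℕ), hGlt e (hGne e hne)⟩ : Fin (2 * n)))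
          (fun e _ hne => Finset.mem_univ _) (fun e₁ _ _ e₂ _ _ h => by
            have := congrArg Fin.val h; exact Fin.ext (by simp only at this; omega)) ?_ ?_
        · -- surjectivity onto the support
          intro j _ hne
          have hc : p ≤ (j : ℕ) ∧ (j : ℕ) < p' ∧ (π.symm j).isLeft = true := by
            by_contra h; exact hne (if_neg h)
          have hjp : (j : ℕ) ≠ p := by
            intro h
            have := hnotrow i j (by rw [h])
            rw [hc.2.2] at this
            exact Bool.noConfusion this
          have hjlt : (j : ℕ) - p - 1 < 2 * n := by have := j.2; omega
          have hG : G ((j : ℕ) - p - 1) = true := by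
            have hlt : p + 1 + ((j : ℕ) - p - 1) < 2 * n := by have := j.2; omega
            refine hGintro _ hlt (by omega) ?_
            have hj : (⟨p + 1 + ((j : ℕ) - p - 1), hlt⟩ : Fin (2 * n)) = j := Fin.ext (by simp only; omega)
            rw [hj]; exact hc.2.2
          refine ⟨⟨(j : ℕ) - p - 1, hjlt⟩, Finset.mem_univ _, ?_, Fin.ext (by simp only; omega)⟩
          simp only [hG, Bool.toNat_true, one_mul]
          positivity
        · -- values agree
          intro e _ hne
          have hG := hGne e hne
          rw [if_pos ⟨by simp only; omega, by have := hGp' e hG; simp only; omega, hGleft e hG⟩]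
          simp only [hG, Bool.toNat_true, one_mul]
          rw [show p + 1 + (e : ℕ) - p = (e : ℕ) + 1 by omega, pow_succ]
      · -- bits of `x - 1` sit at column positions `p + b`
        intro b hb
        have hxm1 : Nat.ofBits (fun e : Fin (2 * n) => G e) - 1 =
            2 ^ (e₀ + 1) * Nat.ofBits (fun e : Fin (2 * n) => G ((e : ℕ) + e₀ + 1)) + (2 ^ e₀ - 1) := by
          rw [hxsplit]; have := Nat.one_le_two_pow (n := e₀); omega
        rw [hxm1, Nat.testBit_two_pow_mul_add _ (by
            have := Nat.one_le_two_pow (n := e₀)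
            have := Nat.pow_lt_pow_right (by norm_num : 1 < 2) (Nat.lt_succ_self e₀)
            omega : 2 ^ e₀ - 1 < 2 ^ (e₀ + 1)),
          Nat.testBit_two_pow_sub_one, Nat.testBit_ofBits] at hb
        by_cases hb0 : b < e₀ + 1
        · -- low bits: `b < e₀`; position `p + b` precedes the first row position after `p`
          rw [if_pos hb0, decide_eq_true_eq] at hb
          have hqn : p + b < 2 * n := by omega
          refine hcol ⟨p + b, hqn⟩ ?_
          by_contra hleft
          rw [Bool.not_eq_false] at hleft
          rcases Nat.eq_zero_or_pos b with hbz | hbpos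
          · exact absurd (hnotrow i ⟨p + b, hqn⟩ (by simp [hbz, hpdef])) (by rw [hleft]; exact Bool.noConfusion)
          · have hG' : G (b - 1) = true := by
              have hlt : p + 1 + (b - 1) < 2 * n := by omega
              refine hGintro _ hlt (by omega) ?_
              have hj : (⟨p + 1 + (b - 1), hlt⟩ : Fin (2 * n)) = ⟨p + b, hqn⟩ := Fin.ext (by simp only; omega)
              rw [hj]; exact hleft
            rw [hmin' (b - 1) (by omega)] at hG'
            exact Bool.false_ne_true hG'
        · -- high bits: `b > e₀` with `G b = true`; position `p + b = j - 1` for the row position `j = p + 1 + b`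
          rw [if_neg hb0] at hb
          by_cases hbN : b - (e₀ + 1) < 2 * n
          · rw [dif_pos hbN] at hb
            have hb' : G b = true := by rwa [show b - (e₀ + 1) + e₀ + 1 = b by omega] at hb
            have hblt := hGlt b hb'
            have hqn : p + b < 2 * n := by omega
            refine hcol ⟨p + b, hqn⟩ ?_
            by_contra hleft
            rw [Bool.not_eq_false] at hleft
            obtain ⟨i₁, hi₁⟩ := hrow ⟨p + b, hqn⟩ hleft
            obtain ⟨i₂, hi₂⟩ := hrow ⟨p + 1 + b, hblt⟩ (hGleft b hb')
            simp only at hi₁ hi₂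
            exact hRR i₁ i₂ (by omega)
          · rw [dif_neg hbN] at hb
            exact absurd hb Bool.false_ne_true)
  rwa [Finset.card_image_of_injective _ (fun a b h => by
      have : (π (Sum.inl a) : ℕ) = (π (Sum.inl b) : ℕ) := by simpa using h
      exact Sum.inl_injective (π.injective (Fin.ext this))), Finset.card_univ, Fintype.card_fin] at key

/-- `⌊log₂ n⌋ ≤ rank M_π` for every cut with pairwise non-adjacent row positions. [this file] -/
theorem log_le_rank_of_noAdjacentRows (n : ℕ) (π : Fin n ⊕ Fin n ≃ Fin (2 * n))
    (hRR : ∀ i i' : Fin n, (π (Sum.inl i') : ℕ) ≠ (π (Sum.inl i) : ℕ) + 1) :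
    Nat.log 2 n ≤ (Matrix.of fun r c : Fin n → Bool =>
      (((liouville (Nat.ofBits (fun k : Fin (2 * n) => Sum.elim r c (π.symm k)) + 1) : ℤ) : ℂ))).rank := by
  have h := le_two_pow_rank_of_noAdjacentRows n π hRR
  calc Nat.log 2 n ≤ Nat.log 2 (2 ^ _) := Nat.log_mono_right h
    _ = _ := Nat.log_pow (by norm_num) _

end Summit.ValiantsHypothesis.ValiantsHypothesis.Theorems.LiouvilleSarnakLiouvilleCutRank.NoAdjacentRows

end
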